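import Mathlib.Analysis.SpecialFunctions.Pow.Deriv
import Mathlib.Analysis.SpecialFunctions.Pow.Continuity

/-!
# `MultiplicationAccessible` (stmt-KontsevichZagierPeriods-12305), line `shifted-family-prime-sieve`:
one-variable analysis of the `y`-fibres of the corner Stokes component `c₂` (`p = 3`)

In the corner blow-up chart `t_k = 1 - yθ_k` (`θ₀ + θ₁ + θ₂ = 1`) of the cube, the component
`c₂ = v^{3x-1} (1 - vζ)^{3s-1} H^{3s} (θ₀θ₁θ₂)^{s-1} (θ₀M₀ + θ₁M₁ + θ₂M₂)` of the Liouville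
rotation 3-form (`ζ = (t₀t₁t₂)^{1/3}`, `S = 1 - y e₂(θ) + y² e₃(θ)`, `H = (1 + ζ + ζ²)/S`,
`M_k` the three shifted monomials in the `t`'s) is, along each `y`-fibre, an elementary function
of one real variable.  This file records the facts about these fibre functions used by the
`y`-direction Newton–Leibniz move (`cornerStokesY`): the value `1/3 ≤ S` on the closed fibre,
continuity on the closed fibre, the values at the two ends (`y = 0`: the Dirichlet face density;
`yθ_k = 1`: zero), and the derivative at interior points together with a uniform bound.
Everything is stated for abstract functions `Zf, Sf, M0f, M1f, M2f, F : ℝ → ℝ` pinned by their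
defining formulas, so that the four-variable statements can instantiate them by `simp`.

References: M. Kontsevich, D. Zagier, *Periods* (2001), §1.2 rule (3); G. Andrews, R. Askey,
R. Roy, *Special Functions* (1999), §1.8 (Dirichlet integrals).
-/

open Set Real

namespace Summit.KontsevichZagierPeriods.TerasomaMultiplication.MultiplicationAccessible

namespace CornerY

/-- For `t ∈ [0,1]` and an exponent `e ≥ 1`, `t ^ e ≤ t`. [folklore] -/
theorem rpow_le_self_of_one_le {t e : ℝ} (h0 : 0 ≤ t) (h1 : t ≤ 1) (he : 1 ≤ e) : t ^ e ≤ t := by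
  rcases h0.lt_or_eq with h0 | h0
  · simpa using Real.rpow_le_rpow_of_exponent_ge h0 h1 he
  · rw [← h0, Real.zero_rpow (by linarith)]

/-- A monomial `a^e₁ b^e₂ c^e₃` in box coordinates `a, b, c ∈ [0,1]` with exponents `≥ 1` lies in
`[0, abc]`. [folklore] -/
theorem monomial_le {a b c e₁ e₂ e₃ : ℝ} (ha : 0 ≤ a) (ha1 : a ≤ 1) (hb : 0 ≤ b) (hb1 : b ≤ 1)
    (hc : 0 ≤ c) (hc1 : c ≤ 1) (h1 : 1 ≤ e₁) (h2 : 1 ≤ e₂) (h3 : 1 ≤ e₃) :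
    0 ≤ a ^ e₁ * b ^ e₂ * c ^ e₃ ∧ a ^ e₁ * b ^ e₂ * c ^ e₃ ≤ a * b * c :=
  ⟨by positivity, mul_le_mul (mul_le_mul (rpow_le_self_of_one_le ha ha1 h1)
    (rpow_le_self_of_one_le hb hb1 h2) (rpow_nonneg hb _) ha)
    (rpow_le_self_of_one_le hc hc1 h3) (rpow_nonneg hc _) (mul_nonneg ha hb)⟩

/-- **`S ≥ 1/3` on the closed fibre.** With `t_k = 1 - yθ_k ∈ [0,1]`, `θ₀ + θ₁ + θ₂ = 1`, the
polynomial `S = 1 - y e₂(θ) + y² e₃(θ)` satisfies `y S = 1 - t₀t₁t₂` and `3 t₀t₁t₂ ≤ t₀ + t₁ + t₂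
= 3 - y`, whence `S ≥ 1/3` (and `S = 1` at `y = 0`). [folklore] -/
theorem third_le_S {θ₀ θ₁ θ₂ y : ℝ} (hθ : θ₀ + θ₁ + θ₂ = 1) (h₀ : 0 ≤ θ₀) (h₁ : 0 ≤ θ₁)
    (h₂ : 0 ≤ θ₂) (hy : 0 ≤ y) (ht₀ : 0 ≤ 1 - y * θ₀) (ht₁ : 0 ≤ 1 - y * θ₁)
    (ht₂ : 0 ≤ 1 - y * θ₂) :
    1 / 3 ≤ 1 - y * (θ₀ * θ₁ + θ₀ * θ₂ + θ₁ * θ₂) + y ^ 2 * (θ₀ * θ₁ * θ₂) := by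
  rcases hy.lt_or_eq with hy | hy
  · have ha : 1 - y * θ₀ ≤ 1 := by nlinarith
    have hb : 1 - y * θ₁ ≤ 1 := by nlinarith
    have hc : 1 - y * θ₂ ≤ 1 := by nlinarith
    have p0 : (1 - y * θ₀) * (1 - y * θ₁) * (1 - y * θ₂) ≤ 1 - y * θ₀ := by
      rw [mul_assoc]; exact mul_le_of_le_one_right ht₀ (mul_le_one₀ hb ht₂ hc)
    have p1 : (1 - y * θ₀) * (1 - y * θ₁) * (1 - y * θ₂) ≤ 1 - y * θ₁ := by
      rw [mul_right_comm]; exact mul_le_of_le_one_left ht₁ (mul_le_one₀ ha ht₂ hc)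
    have p2 : (1 - y * θ₀) * (1 - y * θ₁) * (1 - y * θ₂) ≤ 1 - y * θ₂ :=
      mul_le_of_le_one_left ht₂ (mul_le_one₀ ha ht₁ hb)
    have key : y * (1 - y * (θ₀ * θ₁ + θ₀ * θ₂ + θ₁ * θ₂) + y ^ 2 * (θ₀ * θ₁ * θ₂)) =
        1 - (1 - y * θ₀) * (1 - y * θ₁) * (1 - y * θ₂) := by linear_combination (-y) * hθ
    have hyθ : y * θ₀ + y * θ₁ + y * θ₂ = y := by linear_combination y * hθ
    have h3 : y * (1 / 3) ≤ y * (1 - y * (θ₀ * θ₁ + θ₀ * θ₂ + θ₁ * θ₂) +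
        y ^ 2 * (θ₀ * θ₁ * θ₂)) := by
      rw [key]; linarith
    exact le_of_mul_le_mul_left h3 hy
  · subst hy; norm_num

/-- The coordinate `y` is at most `3` on the chart domain (`yθ_k < 1`, `Σθ_k = 1`). [folklore] -/
theorem y_le_three {θ₀ θ₁ θ₂ y : ℝ} (hθ : θ₀ + θ₁ + θ₂ = 1) (hy₀ : y * θ₀ ≤ 1) (hy₁ : y * θ₁ ≤ 1)
    (hy₂ : y * θ₂ ≤ 1) : y ≤ 3 := by
  have : y * θ₀ + y * θ₁ + y * θ₂ = y := by linear_combination y * hθ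
  linarith

/-- Derivative of a box monomial `(1 - aθ₀)^{e₀}(1 - aθ₁)^{e₁}(1 - aθ₂)^{e₂}` along `a`, in
logarithmic form (all bases positive). [folklore] -/
theorem hasDerivAt_monomial {θ₀ θ₁ θ₂ e₀ e₁ e₂ y : ℝ} (h0 : 0 < 1 - y * θ₀)
    (h1 : 0 < 1 - y * θ₁) (h2 : 0 < 1 - y * θ₂) (M : ℝ → ℝ)
    (hM : ∀ a, M a = (1 - a * θ₀) ^ e₀ * (1 - a * θ₁) ^ e₁ * (1 - a * θ₂) ^ e₂) :
    HasDerivAt M (-(M y * (e₀ * θ₀ / (1 - y * θ₀) + e₁ * θ₁ / (1 - y * θ₁) +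
      e₂ * θ₂ / (1 - y * θ₂)))) y := by
  have dt : ∀ θ : ℝ, HasDerivAt (fun a : ℝ => 1 - a * θ) (-θ) y := fun θ => by
    simpa using ((hasDerivAt_id y).mul_const θ).const_sub 1
  have h := (((dt θ₀).rpow_const (p := e₀) (Or.inl h0.ne')).fun_mul
    ((dt θ₁).rpow_const (p := e₁) (Or.inl h1.ne'))).fun_mul
    ((dt θ₂).rpow_const (p := e₂) (Or.inl h2.ne'))
  refine (h.congr_of_eventuallyEq (Filter.Eventually.of_forall hM)).congr_deriv ?_
  rw [Real.rpow_sub_one h0.ne' e₀, Real.rpow_sub_one h1.ne' e₁, Real.rpow_sub_one h2.ne' e₂, hM]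
  field_simp
  ring

/-- Derivative of the geometric mean `ζ = ((1 - aθ₀)(1 - aθ₁)(1 - aθ₂))^{1/3}` along `a`:
`ζ' = ζ p'/(3p)`, `p` the product. [folklore] -/
theorem hasDerivAt_geomMean {θ₀ θ₁ θ₂ y : ℝ}
    (hp : 0 < (1 - y * θ₀) * (1 - y * θ₁) * (1 - y * θ₂)) (Zf : ℝ → ℝ)
    (hZf : ∀ a, Zf a = ((1 - a * θ₀) * (1 - a * θ₁) * (1 - a * θ₂)) ^ ((1:ℝ) / 3)) :
    HasDerivAt Zf (Zf y * (-(θ₀ * ((1 - y * θ₁) * (1 - y * θ₂)) +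
      θ₁ * ((1 - y * θ₀) * (1 - y * θ₂)) + θ₂ * ((1 - y * θ₀) * (1 - y * θ₁)))) /
      (3 * ((1 - y * θ₀) * (1 - y * θ₁) * (1 - y * θ₂)))) y := by
  have dt : ∀ θ : ℝ, HasDerivAt (fun a : ℝ => 1 - a * θ) (-θ) y := fun θ => by
    simpa using ((hasDerivAt_id y).mul_const θ).const_sub 1
  have h := (((dt θ₀).fun_mul (dt θ₁)).fun_mul (dt θ₂)).rpow_const (p := (1:ℝ) / 3)
    (Or.inl hp.ne')
  refine (h.congr_of_eventuallyEq (Filter.Eventually.of_forall hZf)).congr_deriv ?_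
  rw [Real.rpow_sub_one hp.ne', ← hZf]
  field_simp
  ring

/-- Derivative of the polynomial `S = 1 - a e₂(θ) + a² e₃(θ)` along `a`. [folklore] -/
theorem hasDerivAt_S {θ₀ θ₁ θ₂ y : ℝ} (Sf : ℝ → ℝ)
    (hSf : ∀ a, Sf a = 1 - a * (θ₀ * θ₁ + θ₀ * θ₂ + θ₁ * θ₂) + a ^ 2 * (θ₀ * θ₁ * θ₂)) :
    HasDerivAt Sf (-(θ₀ * θ₁ + θ₀ * θ₂ + θ₁ * θ₂) + 2 * y * (θ₀ * θ₁ * θ₂)) y := by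
  have h := (((hasDerivAt_id' y).mul_const (θ₀ * θ₁ + θ₀ * θ₂ + θ₁ * θ₂)).const_sub 1).fun_add
    (((hasDerivAt_id' y).fun_mul (hasDerivAt_id' y)).mul_const (θ₀ * θ₁ * θ₂))
  refine (h.congr_of_eventuallyEq (Filter.Eventually.of_forall fun a => ?_)).congr_deriv (by ring)
  simp only [hSf]; ring

/-- The pole-absorbing estimate for the logarithmic derivative of a box monomial:
if `0 ≤ m ≤ t₀t₁t₂` then `|m (c₀θ₀/t₀ + c₁θ₁/t₁ + c₂θ₂/t₂)| ≤ x` for `0 ≤ c_k ≤ x`. [folklore] -/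
theorem abs_logDeriv_le {θ₀ θ₁ θ₂ t0 t1 t2 m c0 c1 c2 x : ℝ} (hθ : θ₀ + θ₁ + θ₂ = 1)
    (hθ₀ : 0 ≤ θ₀) (hθ₁ : 0 ≤ θ₁) (hθ₂ : 0 ≤ θ₂) (h0 : 0 < t0) (h1 : 0 < t1) (h2 : 0 < t2)
    (ht0 : t0 ≤ 1) (ht1 : t1 ≤ 1) (ht2 : t2 ≤ 1) (hm : 0 ≤ m) (hmp : m ≤ t0 * t1 * t2)
    (hc0 : 0 ≤ c0) (hc0x : c0 ≤ x) (hc1 : 0 ≤ c1) (hc1x : c1 ≤ x) (hc2 : 0 ≤ c2) (hc2x : c2 ≤ x) :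
    |-(m * (c0 * θ₀ / t0 + c1 * θ₁ / t1 + c2 * θ₂ / t2))| ≤ x := by
  have hx : 0 ≤ x := hc0.trans hc0x
  have hpt0 : t0 * t1 * t2 ≤ t0 := by
    rw [mul_assoc]; exact mul_le_of_le_one_right h0.le (mul_le_one₀ ht1 h2.le ht2)
  have hpt1 : t0 * t1 * t2 ≤ t1 := by
    rw [mul_right_comm]; exact mul_le_of_le_one_left h1.le (mul_le_one₀ ht0 h2.le ht2)
  have hpt2 : t0 * t1 * t2 ≤ t2 := mul_le_of_le_one_left h2.le (mul_le_one₀ ht0 h1.le ht1)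
  have q0 : m / t0 ≤ 1 := div_le_one_of_le₀ (hmp.trans hpt0) h0.le
  have q1 : m / t1 ≤ 1 := div_le_one_of_le₀ (hmp.trans hpt1) h1.le
  have q2 : m / t2 ≤ 1 := div_le_one_of_le₀ (hmp.trans hpt2) h2.le
  have e0 : c0 * θ₀ * (m / t0) ≤ x * θ₀ * 1 :=
    mul_le_mul (mul_le_mul_of_nonneg_right hc0x hθ₀) q0 (by positivity) (by positivity)
  have e1 : c1 * θ₁ * (m / t1) ≤ x * θ₁ * 1 :=
    mul_le_mul (mul_le_mul_of_nonneg_right hc1x hθ₁) q1 (by positivity) (by positivity)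
  have e2 : c2 * θ₂ * (m / t2) ≤ x * θ₂ * 1 :=
    mul_le_mul (mul_le_mul_of_nonneg_right hc2x hθ₂) q2 (by positivity) (by positivity)
  rw [abs_neg, abs_of_nonneg (by positivity)]
  have hxθ : x * θ₀ + x * θ₁ + x * θ₂ = x := by linear_combination x * hθ
  calc m * (c0 * θ₀ / t0 + c1 * θ₁ / t1 + c2 * θ₂ / t2)
      = c0 * θ₀ * (m / t0) + c1 * θ₁ * (m / t1) + c2 * θ₂ * (m / t2) := by ring
    _ ≤ x := by linarith

/-- The pole-absorbing estimates for `ζ' B` and `H' B`: with `ζ' = ζ p'/(3p)`, `|p'| ≤ 1`,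
`0 ≤ B ≤ p`, `S ≥ 1/3`, `1 ≤ N ≤ 3`, `|S'| ≤ 9`, one has `|ζ' B| ≤ 1/3` and
`|((1 + 2ζ) ζ' S - N S') B / S²| ≤ 300`. [folklore] -/
theorem abs_ZB_HB_le {Z pd p B Sv N Sd Zd Hd : ℝ} (hZ0 : 0 < Z) (hZ1 : Z ≤ 1) (hpd : |pd| ≤ 1)
    (hp : 0 < p) (hB0 : 0 ≤ B) (hBp : B ≤ p) (hp1 : p ≤ 1) (hS3 : 1 / 3 ≤ Sv) (hN1 : 1 ≤ N)
    (hN3 : N ≤ 3) (hSd : |Sd| ≤ 9) (hZd : Z * pd / (3 * p) = Zd)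
    (hHd : ((1 + 2 * Z) * Zd * Sv - N * Sd) / Sv ^ 2 = Hd) :
    |Zd * B| ≤ 1 / 3 ∧ |Hd * B| ≤ 300 := by
  have hS0 : 0 < Sv := by linarith
  have hZB : |Zd * B| ≤ 1 / 3 := by
    have : Zd * B = (Z * pd / 3) * (B / p) := by rw [← hZd]; ring
    rw [this, abs_mul]
    have hb1 : |Z * pd / 3| ≤ 1 / 3 := by
      rw [abs_div, abs_mul, abs_of_pos hZ0, abs_of_pos (by norm_num : (0:ℝ) < 3)]
      have := mul_le_mul hZ1 hpd (abs_nonneg _) zero_le_one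
      linarith
    have hb2 : |B / p| ≤ 1 := by
      rw [abs_of_nonneg (div_nonneg hB0 hp.le)]; exact div_le_one_of_le₀ hBp hp.le
    calc |Z * pd / 3| * |B / p| ≤ 1 / 3 * 1 := mul_le_mul hb1 hb2 (abs_nonneg _) (by norm_num)
      _ = 1 / 3 := by norm_num
  refine ⟨hZB, ?_⟩
  have a1 : |(1 + 2 * Z) * (Zd * B) * Sv| ≤ 3 * (1 / 3) * Sv := by
    rw [abs_mul, abs_mul, abs_of_pos hS0, abs_of_nonneg (by positivity : (0:ℝ) ≤ 1 + 2 * Z)]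
    refine mul_le_mul_of_nonneg_right ?_ hS0.le
    exact mul_le_mul (by linarith) hZB (abs_nonneg _) (by norm_num)
  have a2 : |N * Sd * B| ≤ 3 * 9 * 1 := by
    rw [abs_mul, abs_mul, abs_of_pos (by linarith : (0:ℝ) < N), abs_of_nonneg hB0]
    exact mul_le_mul (mul_le_mul hN3 hSd (abs_nonneg _) (by norm_num)) (hBp.trans hp1) hB0
      (by norm_num)
  have hnum : |(1 + 2 * Z) * (Zd * B) * Sv - N * Sd * B| ≤ Sv + 27 := by
    linarith [abs_sub ((1 + 2 * Z) * (Zd * B) * Sv) (N * Sd * B)]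
  have : Hd * B = ((1 + 2 * Z) * (Zd * B) * Sv - N * Sd * B) / Sv ^ 2 := by rw [← hHd]; ring
  rw [this, abs_div, abs_of_pos (by positivity : (0:ℝ) < Sv ^ 2), div_le_iff₀ (by positivity)]
  have key := mul_nonneg (sub_nonneg.2 hS3) (by positivity : (0:ℝ) ≤ 300 * Sv + 99)
  linarith

/-- Assembling the three bounded terms of `∂_y c₂`. [folklore] -/
theorem three_terms_le {x s v E k Ga Gb Ha Hb Q ZB HB Bd : ℝ} (hs : 3 ≤ s) (hx : 0 ≤ x)
    (hv0 : 0 ≤ v) (hv1 : v ≤ 1) (hE0 : 0 ≤ E) (hE1 : E ≤ 1) (hk0 : 0 ≤ k) (hk1 : k ≤ 1)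
    (hGa0 : 0 ≤ Ga) (hGa1 : Ga ≤ 1) (hGb0 : 0 ≤ Gb) (hGb1 : Gb ≤ 1) (hQ : 0 < Q)
    (hHa0 : 0 ≤ Ha) (hHaQ : Ha ≤ Q) (hHb0 : 0 ≤ Hb) (hHbQ : Hb ≤ Q)
    (hZB : |ZB| ≤ 1 / 3) (hHB : |HB| ≤ 300) (hBd : |Bd| ≤ x) :
    |-(E * k * (3 * s - 1) * Gb * v * Ha) * ZB + E * k * (3 * s) * Ga * Hb * HB +
      E * Ga * Ha * k * Bd| ≤ Q * (1000 * s + 3 * x) := by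
  have hs1 : 0 ≤ 3 * s - 1 := by linarith
  have hs0 : 0 ≤ 3 * s := by linarith
  have hEk : E * k ≤ 1 := mul_le_one₀ hE1 hk0 hk1
  have hEk0 : 0 ≤ E * k := mul_nonneg hE0 hk0
  have hT1 : |-(E * k * (3 * s - 1) * Gb * v * Ha) * ZB| ≤ (3 * s - 1) * Q * (1 / 3) := by
    rw [abs_mul, abs_neg, abs_of_nonneg (by positivity)]
    have a : E * k * (3 * s - 1) * Gb * v ≤ 1 * (3 * s - 1) * 1 * 1 :=
      mul_le_mul (mul_le_mul (mul_le_mul_of_nonneg_right hEk hs1) hGb1 hGb0 (by positivity))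
        hv1 hv0 (by positivity)
    have b : E * k * (3 * s - 1) * Gb * v * Ha ≤ 1 * (3 * s - 1) * 1 * 1 * Q :=
      mul_le_mul a hHaQ hHa0 (by positivity)
    have c := mul_le_mul b hZB (abs_nonneg _) (by positivity)
    linarith
  have hT2 : |E * k * (3 * s) * Ga * Hb * HB| ≤ 3 * s * Q * 300 := by
    rw [abs_mul, abs_of_nonneg (by positivity)]
    have a : E * k * (3 * s) * Ga ≤ 1 * (3 * s) * 1 :=
      mul_le_mul (mul_le_mul_of_nonneg_right hEk hs0) hGa1 hGa0 (by positivity)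
    have b : E * k * (3 * s) * Ga * Hb ≤ 1 * (3 * s) * 1 * Q := mul_le_mul a hHbQ hHb0 (by positivity)
    have c := mul_le_mul b hHB (abs_nonneg _) (by positivity)
    linarith
  have hT3 : |E * Ga * Ha * k * Bd| ≤ Q * x := by
    rw [abs_mul, abs_of_nonneg (by positivity)]
    have a : E * Ga * Ha ≤ 1 * Q := mul_le_mul (mul_le_one₀ hE1 hGa0 hGa1) hHaQ hHa0 (by positivity)
    have b : E * Ga * Ha * k ≤ 1 * Q * 1 := mul_le_mul a hk1 hk0 (by positivity)
    have c := mul_le_mul b hBd (abs_nonneg _) (by positivity)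
    linarith
  have key := mul_nonneg hQ.le (show (0:ℝ) ≤ 99 * s + 2 * x + 1 / 3 by linarith)
  have := (abs_add_three _ _ _).trans (add_le_add (add_le_add hT1 hT2) hT3)
  linarith

/-- **Continuity of the fibre function on the closed fibre `[0, T]`** (`Tθ_k ≤ 1`): every real power
has a positive exponent, and the only denominator `S` is `≥ 1/3` there. [folklore] -/
theorem fibre_continuousOn {x s θ₀ θ₁ θ₂ v T : ℝ} (hx : 2 ≤ x) (hs : 3 ≤ s)
    (hθ₀ : 0 ≤ θ₀) (hθ₁ : 0 ≤ θ₁) (hθ₂ : 0 ≤ θ₂) (hθ : θ₀ + θ₁ + θ₂ = 1)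
    (hT₀ : T * θ₀ ≤ 1) (hT₁ : T * θ₁ ≤ 1) (hT₂ : T * θ₂ ≤ 1) (Zf Sf M0f M1f M2f F : ℝ → ℝ)
    (hZf : ∀ a, Zf a = ((1 - a * θ₀) * (1 - a * θ₁) * (1 - a * θ₂)) ^ ((1:ℝ) / 3))
    (hSf : ∀ a, Sf a = 1 - a * (θ₀ * θ₁ + θ₀ * θ₂ + θ₁ * θ₂) + a ^ 2 * (θ₀ * θ₁ * θ₂))
    (hM0f : ∀ a, M0f a =
      (1 - a * θ₀) ^ x * (1 - a * θ₁) ^ (x - 2 / 3) * (1 - a * θ₂) ^ (x - 1 / 3))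
    (hM1f : ∀ a, M1f a =
      (1 - a * θ₀) ^ (x - 1 / 3) * (1 - a * θ₁) ^ x * (1 - a * θ₂) ^ (x - 2 / 3))
    (hM2f : ∀ a, M2f a =
      (1 - a * θ₀) ^ (x - 2 / 3) * (1 - a * θ₁) ^ (x - 1 / 3) * (1 - a * θ₂) ^ x)
    (hF : ∀ a, F a = v ^ (3 * x - 1) * (1 - v * Zf a) ^ (3 * s - 1) *
      ((1 + Zf a + Zf a ^ 2) / Sf a) ^ (3 * s) * (θ₀ * θ₁ * θ₂) ^ (s - 1) *
      (θ₀ * M0f a + θ₁ * M1f a + θ₂ * M2f a)) :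
    ContinuousOn F (Icc 0 T) := by
  have ct : ∀ θ : ℝ, Continuous fun a : ℝ => 1 - a * θ := fun θ => by fun_prop
  have cpow : ∀ θ e : ℝ, 0 ≤ e → Continuous fun a : ℝ => (1 - a * θ) ^ e := fun θ e he =>
    (ct θ).rpow_const fun _ => Or.inr he
  have hx0 : 0 ≤ x := by linarith
  have hx1 : 0 ≤ x - 1 / 3 := by linarith
  have hx2 : 0 ≤ x - 2 / 3 := by linarith
  have cZ : Continuous Zf := by
    rw [show Zf = _ from funext hZf]
    exact (((ct θ₀).mul (ct θ₁)).mul (ct θ₂)).rpow_const fun _ => Or.inr (by norm_num)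
  have cM0 : Continuous M0f := by
    rw [show M0f = _ from funext hM0f]
    exact ((cpow θ₀ x hx0).mul (cpow θ₁ _ hx2)).mul (cpow θ₂ _ hx1)
  have cM1 : Continuous M1f := by
    rw [show M1f = _ from funext hM1f]
    exact ((cpow θ₀ _ hx1).mul (cpow θ₁ x hx0)).mul (cpow θ₂ _ hx2)
  have cM2 : Continuous M2f := by
    rw [show M2f = _ from funext hM2f]
    exact ((cpow θ₀ _ hx2).mul (cpow θ₁ _ hx1)).mul (cpow θ₂ x hx0)
  have cS : Continuous Sf := by rw [show Sf = _ from funext hSf]; fun_prop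
  have hSpos : ∀ a ∈ Icc (0:ℝ) T, 0 < Sf a := by
    intro a ha
    rw [hSf]
    refine lt_of_lt_of_le (by norm_num) (third_le_S hθ hθ₀ hθ₁ hθ₂ ha.1 ?_ ?_ ?_)
    · nlinarith [mul_le_mul_of_nonneg_right ha.2 hθ₀]
    · nlinarith [mul_le_mul_of_nonneg_right ha.2 hθ₁]
    · nlinarith [mul_le_mul_of_nonneg_right ha.2 hθ₂]
  have cH : ContinuousOn (fun a => (1 + Zf a + Zf a ^ 2) / Sf a) (Icc 0 T) :=
    (by fun_prop : Continuous fun a => 1 + Zf a + Zf a ^ 2).continuousOn.div cS.continuousOn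
      fun a ha => (hSpos a ha).ne'
  rw [show F = _ from funext hF]
  refine (((continuousOn_const.mul ?_).mul (cH.rpow_const fun a _ => Or.inr (by linarith))).mul
    continuousOn_const).mul (by fun_prop : Continuous fun a => θ₀ * M0f a + θ₁ * M1f a +
      θ₂ * M2f a).continuousOn
  exact ((continuous_const.sub (continuous_const.mul cZ)).rpow_const
    fun _ => Or.inr (by linarith)).continuousOn

/-- **The value at the exceptional face `y = 0`**: all `t_k = 1`, `ζ = 1`, `S = 1`, `H = 3`,
`M_k = 1`, so `F 0 = v^{3x-1}(1-v)^{3s-1} 3^{3s} (θ₀θ₁θ₂)^{s-1}` — the Dirichlet face density.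
[cite: KontsevichZagier2001, §1.2 rule (3)] -/
theorem fibre_zero {x s θ₀ θ₁ θ₂ v : ℝ} (hθ : θ₀ + θ₁ + θ₂ = 1) (Zf Sf M0f M1f M2f F : ℝ → ℝ)
    (hZf : ∀ a, Zf a = ((1 - a * θ₀) * (1 - a * θ₁) * (1 - a * θ₂)) ^ ((1:ℝ) / 3))
    (hSf : ∀ a, Sf a = 1 - a * (θ₀ * θ₁ + θ₀ * θ₂ + θ₁ * θ₂) + a ^ 2 * (θ₀ * θ₁ * θ₂))
    (hM0f : ∀ a, M0f a =
      (1 - a * θ₀) ^ x * (1 - a * θ₁) ^ (x - 2 / 3) * (1 - a * θ₂) ^ (x - 1 / 3))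
    (hM1f : ∀ a, M1f a =
      (1 - a * θ₀) ^ (x - 1 / 3) * (1 - a * θ₁) ^ x * (1 - a * θ₂) ^ (x - 2 / 3))
    (hM2f : ∀ a, M2f a =
      (1 - a * θ₀) ^ (x - 2 / 3) * (1 - a * θ₁) ^ (x - 1 / 3) * (1 - a * θ₂) ^ x)
    (hF : ∀ a, F a = v ^ (3 * x - 1) * (1 - v * Zf a) ^ (3 * s - 1) *
      ((1 + Zf a + Zf a ^ 2) / Sf a) ^ (3 * s) * (θ₀ * θ₁ * θ₂) ^ (s - 1) *
      (θ₀ * M0f a + θ₁ * M1f a + θ₂ * M2f a)) :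
    F 0 = v ^ (3 * x - 1) * (1 - v) ^ (3 * s - 1) * (3:ℝ) ^ (3 * s) *
      (θ₀ * θ₁ * θ₂) ^ (s - 1) := by
  have hZ0 : Zf 0 = 1 := by rw [hZf]; simp
  have hS0 : Sf 0 = 1 := by rw [hSf]; simp
  have h0 : M0f 0 = 1 := by rw [hM0f]; simp
  have h1 : M1f 0 = 1 := by rw [hM1f]; simp
  have h2 : M2f 0 = 1 := by rw [hM2f]; simp
  rw [hF, hZ0, hS0, h0, h1, h2]
  have h3 : (1 + 1 + (1:ℝ) ^ 2) / 1 = 3 := by norm_num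
  have hb : θ₀ * 1 + θ₁ * 1 + θ₂ * 1 = 1 := by linarith
  rw [h3, hb, mul_one, mul_one]

/-- **The value at the far end of the fibre**: if `Tθ_k = 1` for some `k` then `t_k = 0`, every
monomial `M_j` contains `t_k` to a positive power, and `F T = 0`. [folklore] -/
theorem fibre_top {x s θ₀ θ₁ θ₂ v T : ℝ} (hx : 2 ≤ x) (hT : T * θ₀ = 1 ∨ T * θ₁ = 1 ∨ T * θ₂ = 1)
    (Zf Sf M0f M1f M2f F : ℝ → ℝ)
    (hM0f : ∀ a, M0f a =
      (1 - a * θ₀) ^ x * (1 - a * θ₁) ^ (x - 2 / 3) * (1 - a * θ₂) ^ (x - 1 / 3))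
    (hM1f : ∀ a, M1f a =
      (1 - a * θ₀) ^ (x - 1 / 3) * (1 - a * θ₁) ^ x * (1 - a * θ₂) ^ (x - 2 / 3))
    (hM2f : ∀ a, M2f a =
      (1 - a * θ₀) ^ (x - 2 / 3) * (1 - a * θ₁) ^ (x - 1 / 3) * (1 - a * θ₂) ^ x)
    (hF : ∀ a, F a = v ^ (3 * x - 1) * (1 - v * Zf a) ^ (3 * s - 1) *
      ((1 + Zf a + Zf a ^ 2) / Sf a) ^ (3 * s) * (θ₀ * θ₁ * θ₂) ^ (s - 1) *
      (θ₀ * M0f a + θ₁ * M1f a + θ₂ * M2f a)) :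
    F T = 0 := by
  have e0 : x ≠ 0 := by positivity
  have e1 : x - 1 / 3 ≠ 0 := ne_of_gt (by linarith)
  have e2 : x - 2 / 3 ≠ 0 := ne_of_gt (by linarith)
  have hM : M0f T = 0 ∧ M1f T = 0 ∧ M2f T = 0 := by
    rw [hM0f, hM1f, hM2f]
    rcases hT with h | h | h
    · have h' : 1 - T * θ₀ = 0 := by linarith
      simp only [h', Real.zero_rpow e0, Real.zero_rpow e1, Real.zero_rpow e2, zero_mul, and_self]
    · have h' : 1 - T * θ₁ = 0 := by linarith
      simp only [h', Real.zero_rpow e0, Real.zero_rpow e1, Real.zero_rpow e2, zero_mul, mul_zero,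
        and_self]
    · have h' : 1 - T * θ₂ = 0 := by linarith
      simp only [h', Real.zero_rpow e0, Real.zero_rpow e1, Real.zero_rpow e2, mul_zero, and_self]
  rw [hF, hM.1, hM.2.1, hM.2.2]; ring

end CornerY

/-- **Continuity of `c₂` on the closed `y`-fibres** (sub-goal `cornerStokesYFibreCont` of the
corner Stokes `y`-move, registered as the continuity input of rule (3) in `cornerStokesY`): the
fibre function `F` is continuous on `[0, T]` whenever `Tθ_k ≤ 1` (`x ≥ 2`, `s ≥ 3`).
[cite: KontsevichZagier2001, §1.2 rule (3)] -/
theorem cornerStokesYFibreCont : ∀ (x s θ₀ θ₁ θ₂ v T : ℝ), 2 ≤ x → 3 ≤ s →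
    0 ≤ θ₀ → 0 ≤ θ₁ → 0 ≤ θ₂ → θ₀ + θ₁ + θ₂ = 1 → T * θ₀ ≤ 1 → T * θ₁ ≤ 1 → T * θ₂ ≤ 1 →
    ∀ (Zf Sf M0f M1f M2f F : ℝ → ℝ),
    (∀ a, Zf a = ((1 - a * θ₀) * (1 - a * θ₁) * (1 - a * θ₂)) ^ ((1:ℝ) / 3)) →
    (∀ a, Sf a = 1 - a * (θ₀ * θ₁ + θ₀ * θ₂ + θ₁ * θ₂) + a ^ 2 * (θ₀ * θ₁ * θ₂)) →
    (∀ a, M0f a = (1 - a * θ₀) ^ x * (1 - a * θ₁) ^ (x - 2 / 3) * (1 - a * θ₂) ^ (x - 1 / 3)) →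
    (∀ a, M1f a = (1 - a * θ₀) ^ (x - 1 / 3) * (1 - a * θ₁) ^ x * (1 - a * θ₂) ^ (x - 2 / 3)) →
    (∀ a, M2f a = (1 - a * θ₀) ^ (x - 2 / 3) * (1 - a * θ₁) ^ (x - 1 / 3) * (1 - a * θ₂) ^ x) →
    (∀ a, F a = v ^ (3 * x - 1) * (1 - v * Zf a) ^ (3 * s - 1) *
      ((1 + Zf a + Zf a ^ 2) / Sf a) ^ (3 * s) * (θ₀ * θ₁ * θ₂) ^ (s - 1) *
      (θ₀ * M0f a + θ₁ * M1f a + θ₂ * M2f a)) →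
    ContinuousOn F (Set.Icc 0 T) :=
  fun _ _ _ _ _ _ _ hx hs h₀ h₁ h₂ hθ hT₀ hT₁ hT₂ Zf Sf M0f M1f M2f F hZf hSf hM0f hM1f hM2f hF =>
    CornerY.fibre_continuousOn hx hs h₀ h₁ h₂ hθ hT₀ hT₁ hT₂ Zf Sf M0f M1f M2f F hZf hSf hM0f hM1f
      hM2f hF

end Summit.KontsevichZagierPeriods.TerasomaMultiplication.MultiplicationAccessible
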